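import Summits.QuantumFields.YangMills.Theorems.BalabanUVNodesN12GuardedChartDerivQLinJunction

/-!
# BalabanUVNodes ∕ N12 — (J-b)∕(J-iii) continued: THE (45)–(46) RIGHT INVERSE OF THE LINEARISED MULTI-LEVEL (0.4)-CONSTRAINT AT A GUARDED NEAR-FLAT
# BACKGROUND — surjectivity of `X ↦ (π(qLin j_i U₀ X c_i))_i` (and of `DΦ_{U₀}(0)`) persists from the flat background to every `U₀` with `‖↑U₀ − 1‖ < ρ′`,
# `ρ′` chosen BEFORE `U₀`, with a real-linear right inverse of the SAME RANGE as the flat one and the letter doubled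

Cell `pub-ymgap` (HUMAN RULINGS D-0062 ∕ D-0149), width seat `pub-ymgap-dag-n10-w1` g2 (harness re-seat of the g0 base; modules A–E of this lineage landed:
`…N12FlatConstraintPlaquetteJunction` p592369, `…N12FlatChartDerivIterLin` p594415, `…N12GuardedChartDerivIterLin` p596651, `…N12GuardedChartDerivDeviation` p600194,
`…N12GuardedChartDerivQLinJunction` p601585); this is module F, answering dag-n12-w1 g2's ask on the bus (INTENT-19, l.28586: *«ONE LINE if a right inverse of `dIterL`∕`qLin` at a
general guarded base `U₀` in your currency already exists or is in flight»*).  Key K1⁷ `stmt-QuantumFields-20542`, `--kind proof --supports … --as helper`; count-neutral; THEOREMS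
ONLY (0 `def`, 0 `sorry`, 0 `instance`, 0 `notation`).  CONSUMED BY NAME, nothing modified: module E (`exists_norm_qLin_sub_qLin_one_le` — the deviation `‖qLin j U X c − qLin j 1 X c‖
≤ C·‖↑U − 1‖·‖↑X‖`; `fderiv_msChart_apply_eq_suProj_qLin` — `(DΦ_U(0)X)_i = π(qLin j U X c)`), module D (`exists_norm_suProj_le`), n07-w1's `Node00.LinearisedAveragingAtBackground`
(`qLin`, `qLin_add`, `qLin_smul`), n07-w2's `Node00.MultiScaleFibreChart` (`msChart`, `suProj`, `constrEnum`), Mathlib (`LinearMap.injective_iff_surjective`, `LinearEquiv.ofBijective`).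

THE PRINT.  [Balaban1985Variational] Sect. C (44)–(46) p. 285: *«Q_k(U₀) is the linearisation of the k-fold averaging operation at the configuration U₀ … there exists a linear
operator H … (45) L^jηQ_jHB = B on Λ_j … (46) |HB| ≦ O(1)|B|»* — the right inverse of the linearised constraint that the linearising transformation (47)–(48) and the
variational problem need at EVERY small-field background `U₀`, not only at the flat one; [Balaban1985Averaging] Prop. 3 (121)–(125) p. 36 (the linearised average at a
background = the flat main term `L(Q(V₀)A)` + terms `O(L²α₀)`); [Balaban1989LargeFieldII] p. 357 (`H_{1,k}`, the linearised minimiser, built on this right inverse).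

WHAT THIS FILE PROVES — «SURJECTIVITY OF THE LINEARISED CONSTRAINT IS AN OPEN CONDITION IN THE BACKGROUND, QUANTITATIVELY».
§1 ([folklore] finite-dimensional linear algebra, no norm on the domain) ★ `exists_rightInverse_of_approx` — an APPROXIMATE linear right inverse `H₀` of a linear map `T` into a
   finite-dimensional normed space (`‖T(H₀y) − y‖ ≤ q‖y‖`, `q < 1`) yields an EXACT one `H₀ ∘ G` with `‖G y‖ ≤ (1 − q)⁻¹‖y‖` — same range as `H₀` (so 𝔰𝔲-valuedness, support,
   slice membership are inherited); `T ∘ H₀` is injective by the lower bound `(1 − q)‖y‖ ≤ ‖T(H₀y)‖`, hence onto (no Neumann series); `surjective_comp_subtype_of_ker` — the slice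
   reduction: `T` onto ∧ every vector is a slice vector plus a `T`-killed one ⟹ `T` restricted to the slice is onto.
§2 (generic torus `P`, any `N`, a finite index `ι` of levels `lv i ≤ k` and bonds `bd i : PBond P (lv i)`) ★★★ `exists_radius_rightInverse_suProj_qLin` — ONE radius `ρ′ > 0`
   depending on `k`, the letter constant `B` and module D∕E's constants ONLY (not on the index set, the flat right inverse or the background) such that every DISPLAYED flat
   right inverse `H₁` (`π(qLin (lv i) 1 (H₁ y) (bd i)) = y i`) with letter `‖↑(H₁y)‖ ≤ B‖y‖` yields at EVERY `U₀` with `‖↑U₀ − 1‖ < ρ′` a right inverse `H₁ ∘ G` of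
   `X ↦ (π(qLin (lv i) U₀ X (bd i)))_i` with `‖G y‖ ≤ 2‖y‖` and `‖↑(H₁(G y))‖ ≤ 2B‖y‖`; `exists_rightInverse_suProj_qLin_of_flat_letter` (one index set);
   ★ `exists_rightInverse_suProj_qLin_of_flat` (letter-free: `B` by finite-dimensionality, `exists_letter_of_linear`).
§3 (NODE 00's objects, `F : T4Family`, n07-w2's chart `msChart`) ★★★ `exists_radius_rightInverse_fderiv_msChart` — ONE `ρ′ > 0` (from `k`, `B`) for ALL determining sets `𝔹`
   carrying a flat right inverse with letter `≤ B` on their enumerated constrained bonds of levels `≤ k` and ALL `U₀` on 35e's plaquette guard with `‖↑U₀ − 1‖ < ρ′`: a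
   real-linear `H = H₁ ∘ G` with `fderiv ℝ (msChart F N K k 𝔹 (M˙U₀) U₀) 0 (H y) = y` — dag-n12-w3's binder `hLH` VERBATIM at a CURVED base — with the letter;
   `exists_rightInverse_fderiv_msChart_of_flat_letter` (one `𝔹`) ∕ ★ `exists_rightInverse_fderiv_msChart_of_flat` (letter-free) ∕ `surjective_fderiv_msChart_of_flat`.

HONEST FRAMING.  The flat right inverse `H₁` is a DISPLAYED hypothesis: for the index bonds of an admissible (`Adm22`) family it is supplied by k0-s1-w1's
`K0Stub1RecordAveragingRightInverse.exists_suRightInverse_qLin_one` (bus l.28502, in flight; the route UnitScaleTilt's `ChartHInv.exists_rightInverse` behind it) — the junction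
edition F′ follows its landing; for an ARBITRARY determining set a flat right inverse can fail to exist (multi-level data need not be consistent) and is NOT claimed.  The
radius `ρ′` EXISTS by the smoothness constants of modules D∕E near the flat configuration; print's explicit `O(L²α₀)` small-field radius is NOT claimed.  Nothing of Bałaban's
analysis asserted; N12 ∕ N07 ∕ N10 NOT discharged; K1⁷ NOT closed; count-neutral (typed 28∕28 · discharged 5∕27 unmoved); one finite 𝕋⁴ programme at fixed ε — R4 closes the
conditional rung `BalabanLadder.UV` only; the YM mass gap (Clay) is NOT proved by any of this.  No `sorry`, no `def`, no `instance`, no `notation`.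
-/

noncomputable section

open scoped BigOperators Matrix.Norms.L2Operator Topology NNReal
open Filter Finset

namespace Summit.QuantumFields.YangMills.BalabanUVNodes.N12GuardedLinAvgRightInverse

open Literature.MathematicalPhysics.QuantumFieldTheory.Balaban1983to89
open T4Continuum (T4Family)
open ExpMeanLog (deltaSU)
open T4AdjointCovarianceUnitary (lieSU)
open B15DeterminingSets
open Node00
open Summit.QuantumFields.YangMills.Theorems.BlockAvgCorrector (stokesConst)
open Summit.QuantumFields.YangMills.BalabanUVNodes.N12GuardedChartDerivDeviation (exists_norm_suProj_le)
open Summit.QuantumFields.YangMills.BalabanUVNodes.N12GuardedChartDerivQLinJunction (exists_norm_qLin_sub_qLin_one_le fderiv_msChart_apply_eq_suProj_qLin)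

/-! ## §1  [folklore] An approximate right inverse into a finite-dimensional space yields an exact one of the same range -/

section Generic

/-- ★ **APPROXIMATE ⟹ EXACT RIGHT INVERSE (finite-dimensional target)**: if `H₀` is a linear approximate right inverse of `T` — `‖T(H₀ y) − y‖ ≤ q‖y‖` with `q < 1` — then
`T ∘ H₀` is injective (`(1 − q)‖y‖ ≤ ‖T(H₀ y)‖`), hence a linear bijection of the finite-dimensional `F`, and `H₀ ∘ (T ∘ H₀)⁻¹` is an exact right inverse of `T`:
there is `G` with `T(H₀(G y)) = y` and `‖G y‖ ≤ (1 − q)⁻¹‖y‖`.  No norm on the domain `E` is used; every property of the range of `H₀` passes to `H₀ ∘ G`. [folklore] -/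
theorem exists_rightInverse_of_approx {E F : Type*} [AddCommGroup E] [Module ℝ E] [NormedAddCommGroup F] [NormedSpace ℝ F] [FiniteDimensional ℝ F]
    (T : E →ₗ[ℝ] F) (H₀ : F →ₗ[ℝ] E) {q : ℝ} (hq : q < 1) (happrox : ∀ y, ‖T (H₀ y) - y‖ ≤ q * ‖y‖) :
    ∃ G : F →ₗ[ℝ] F, (∀ y, T (H₀ (G y)) = y) ∧ ∀ y, ‖G y‖ ≤ (1 - q)⁻¹ * ‖y‖ := by
  set G₀ : F →ₗ[ℝ] F := T ∘ₗ H₀ with hG₀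
  have hG₀app : ∀ y, G₀ y = T (H₀ y) := fun _ => rfl
  have hlow : ∀ y, (1 - q) * ‖y‖ ≤ ‖G₀ y‖ := fun y => by
    have h1 : ‖y‖ ≤ ‖G₀ y‖ + ‖G₀ y - y‖ := by
      calc ‖y‖ = ‖G₀ y - (G₀ y - y)‖ := by rw [sub_sub_cancel]
        _ ≤ ‖G₀ y‖ + ‖G₀ y - y‖ := norm_sub_le _ _
    have h2 : ‖G₀ y - y‖ ≤ q * ‖y‖ := happrox y
    nlinarith
  have h1q : 0 < 1 - q := sub_pos.2 hq
  have hinj : Function.Injective G₀ := fun y y' h => by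
    have hle := hlow (y - y')
    rw [map_sub, h, sub_self, norm_zero] at hle
    have h0 : ‖y - y'‖ ≤ 0 := by
      by_contra hcon
      have hpos : 0 < ‖y - y'‖ := lt_of_not_ge hcon
      nlinarith
    exact sub_eq_zero.1 (norm_le_zero_iff.1 h0)
  have hbij : Function.Bijective G₀ := ⟨hinj, LinearMap.injective_iff_surjective.1 hinj⟩
  set e : F ≃ₗ[ℝ] F := LinearEquiv.ofBijective G₀ hbij with he
  have heapp : ∀ z, e z = G₀ z := fun _ => rfl
  have hsymm : ∀ y, G₀ (e.symm y) = y := fun y => by rw [← heapp, LinearEquiv.apply_symm_apply]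
  refine ⟨(e.symm : F →ₗ[ℝ] F), fun y => ?_, fun y => ?_⟩
  · rw [LinearEquiv.coe_coe, ← hG₀app, hsymm]
  · have h := hlow (e.symm y)
    rw [hsymm] at h
    rw [LinearEquiv.coe_coe, inv_mul_eq_div, le_div_iff₀ h1q, mul_comm]
    exact h

/-- **The slice reduction**: a surjective linear map stays surjective on a subspace `S` through which every vector factors modulo the kernel (`x = s + (x − s)`, `s ∈ S`,
`T(x − s) = 0`) — the shape in which a right inverse on ALL fields plus a linearised gauge-fixing statement gives a right inverse from a gauge slice. [folklore] -/
theorem surjective_comp_subtype_of_ker {R E F : Type*} [Ring R] [AddCommGroup E] [Module R E] [AddCommGroup F] [Module R F]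
    (T : E →ₗ[R] F) (S : Submodule R E) (hT : Function.Surjective T) (hS : ∀ x, ∃ s ∈ S, x - s ∈ LinearMap.ker T) :
    Function.Surjective (T ∘ₗ S.subtype) := fun y => by
  obtain ⟨x, rfl⟩ := hT y
  obtain ⟨s, hs, hker⟩ := hS x
  refine ⟨⟨s, hs⟩, ?_⟩
  rw [LinearMap.mem_ker, map_sub, sub_eq_zero] at hker
  rw [LinearMap.comp_apply, Submodule.subtype_apply]
  exact hker.symm

end Generic

/-! ## §2  At n07-w1's `qLin`: the right inverse persists from the flat background to every `‖↑U₀ − 1‖ < ρ′` -/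

section QLin

variable {P : Params} {N : ℕ} [NeZero N] {ι : Type*} [Fintype ι]

omit [NeZero N] [Fintype ι] in
/-- The linearised multi-level constraint `X ↦ (π(qLin (lv i) U X (bd i)))_i` as a real-linear map (n07-w1's `qLin_add`∕`qLin_smul` + linearity of `π = suProj`), packaged
for the proofs below (a term inside proofs only; no `def`). [cite: Balaban1985Variational, (44) p.285] -/
theorem exists_linearMap_suProj_qLin (lv : ι → ℕ) (bd : (i : ι) → PBond P (lv i)) (U : GaugeField P 0 (SU N)) :
    ∃ T : (PBond P 0 → lieSU (Fin N)) →ₗ[ℝ] (ι → lieSU (Fin N)), ∀ X i, T X i = suProj N (qLin (lv i) U X (bd i)) :=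
  ⟨{ toFun := fun X i => suProj N (qLin (lv i) U X (bd i))
     map_add' := fun X X' => funext fun i => by simp only [qLin_add, Pi.add_apply, map_add]
     map_smul' := fun a X => funext fun i => by simp only [qLin_smul, Pi.smul_apply, map_smul, RingHom.id_apply] },
    fun _ _ => rfl⟩

/-- ★★★ **ONE RADIUS FOR THE (45)–(46) RIGHT INVERSE AT ALL GUARDED NEAR-FLAT BACKGROUNDS, WITH THE LETTER.**  For levels `≤ k` and a letter constant `B ≥ 0` there is
`ρ′ > 0` — depending on module E's `C, ρ`, module D's bound `c_π` of `π`, `k` and `B` ONLY (not on the index set, the right inverse, or the background) — such that: for EVERY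
finite index `ι` (levels `lv i ≤ k`, bonds `bd i`), EVERY real-linear right inverse `H₁` AT THE FLAT BACKGROUND (`π(qLin (lv i) 1 (H₁ y) (bd i)) = y i`) with letter
`‖↑(H₁ y)‖ ≤ B‖y‖` (fields read as matrices, operator-norm sup — module E's currency), and EVERY configuration `U₀` with `‖↑U₀ − 1‖ < ρ′`, some real-linear `G` with `‖G y‖ ≤ 2‖y‖`
makes `H₁ ∘ G` a right inverse AT `U₀`: `π(qLin (lv i) U₀ (H₁(G y)) (bd i)) = y i`, letter `‖↑(H₁(G y))‖ ≤ 2B‖y‖`.  Proof: `‖π(qLin j U₀ X c − qLin j 1 X c)‖ ≤ c_π C‖↑U₀ − 1‖‖↑X‖`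
(modules D∕E) makes `H₁` a `½`-approximate right inverse at `U₀` once `c_π C B ρ′ ≤ ½`; then §1. [cite: Balaban1985Variational, (44)-(46) p.285; Balaban1985Averaging, Prop. 3 (121)-(125) p.36] -/
theorem exists_radius_rightInverse_suProj_qLin (k : ℕ) {B : ℝ} (hB0 : 0 ≤ B) :
    ∃ ρ' : ℝ, 0 < ρ' ∧ ∀ {ι : Type*} [Fintype ι] (lv : ι → ℕ) (_ : ∀ i, lv i ≤ k) (bd : (i : ι) → PBond P (lv i))
      (H₁ : (ι → lieSU (Fin N)) →ₗ[ℝ] (PBond P 0 → lieSU (Fin N)))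
      (_ : ∀ y i, suProj N (qLin (lv i) (1 : GaugeField P 0 (SU N)) (H₁ y) (bd i)) = y i)
      (_ : ∀ y, ‖(fun b => (H₁ y b : Matrix (Fin N) (Fin N) ℂ))‖ ≤ B * ‖y‖)
      (U : GaugeField P 0 (SU N)), ‖coeField U - 1‖ < ρ' →
      ∃ G : (ι → lieSU (Fin N)) →ₗ[ℝ] (ι → lieSU (Fin N)),
        (∀ y i, suProj N (qLin (lv i) U (H₁ (G y)) (bd i)) = y i) ∧ (∀ y, ‖G y‖ ≤ 2 * ‖y‖) ∧
          ∀ y, ‖(fun b => (H₁ (G y) b : Matrix (Fin N) (Fin N) ℂ))‖ ≤ 2 * B * ‖y‖ := by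
  obtain ⟨C, ρ, hC, hρ, hdev⟩ := exists_norm_qLin_sub_qLin_one_le (P := P) (N := N) k
  obtain ⟨cπ, hcπ, hπ⟩ := exists_norm_suProj_le (N := N)
  refine ⟨min ρ (1 / (2 * (cπ * C * B + 1))), lt_min hρ (by positivity), fun {ι} _ lv hlv bd H₁ h₁ hB U hU => ?_⟩
  have hUρ : ‖coeField U - 1‖ < ρ := lt_of_lt_of_le hU (min_le_left _ _)
  have hU2 : ‖coeField U - 1‖ ≤ 1 / (2 * (cπ * C * B + 1)) := (le_of_lt hU).trans (min_le_right _ _)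
  obtain ⟨T, hT⟩ := exists_linearMap_suProj_qLin (N := N) lv bd U
  -- `H₁` is a `½`-approximate right inverse of `T` at `U`
  have happrox : ∀ y, ‖T (H₁ y) - y‖ ≤ (1 / 2 : ℝ) * ‖y‖ := fun y => by
    refine (pi_norm_le_iff_of_nonneg (by positivity)).2 fun i => ?_
    have hcomp : (T (H₁ y) - y) i = suProj N (qLin (lv i) U (H₁ y) (bd i) - qLin (lv i) (1 : GaugeField P 0 (SU N)) (H₁ y) (bd i)) := by
      rw [Pi.sub_apply, hT, map_sub, h₁]
    rw [hcomp]
    have hsmall : cπ * (C * (1 / (2 * (cπ * C * B + 1))) * (B * ‖y‖)) ≤ 1 / 2 * ‖y‖ := by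
      rw [show cπ * (C * (1 / (2 * (cπ * C * B + 1))) * (B * ‖y‖)) = cπ * C * B * ‖y‖ / (2 * (cπ * C * B + 1)) by ring,
        div_le_iff₀ (by positivity : (0 : ℝ) < 2 * (cπ * C * B + 1)),
        show 1 / 2 * ‖y‖ * (2 * (cπ * C * B + 1)) = cπ * C * B * ‖y‖ + ‖y‖ by ring]
      linarith [norm_nonneg y]
    calc ‖suProj N (qLin (lv i) U (H₁ y) (bd i) - qLin (lv i) (1 : GaugeField P 0 (SU N)) (H₁ y) (bd i))‖
        ≤ cπ * ‖qLin (lv i) U (H₁ y) (bd i) - qLin (lv i) (1 : GaugeField P 0 (SU N)) (H₁ y) (bd i)‖ := hπ _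
      _ ≤ cπ * (C * ‖coeField U - 1‖ * ‖(fun b => (H₁ y b : Matrix (Fin N) (Fin N) ℂ))‖) :=
          mul_le_mul_of_nonneg_left (hdev _ (hlv i) U hUρ (H₁ y) (bd i)) hcπ
      _ ≤ cπ * (C * (1 / (2 * (cπ * C * B + 1))) * (B * ‖y‖)) := by gcongr; exact hB y
      _ ≤ 1 / 2 * ‖y‖ := hsmall
  obtain ⟨G, hG, hGn⟩ := exists_rightInverse_of_approx T H₁ (by norm_num : (1 / 2 : ℝ) < 1) happrox
  have hGn' : ∀ y, ‖G y‖ ≤ 2 * ‖y‖ := fun y => by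
    have h := hGn y
    norm_num at h
    exact h
  refine ⟨G, fun y i => ?_, hGn', fun y => ?_⟩
  · have h := congrFun (hG y) i
    rwa [hT] at h
  · calc ‖(fun b => (H₁ (G y) b : Matrix (Fin N) (Fin N) ℂ))‖ ≤ B * ‖G y‖ := hB (G y)
      _ ≤ B * (2 * ‖y‖) := mul_le_mul_of_nonneg_left (hGn' y) hB0
      _ = 2 * B * ‖y‖ := by ring

/-- ★★★ **THE (45)–(46) RIGHT INVERSE AT A GUARDED NEAR-FLAT BACKGROUND, WITH THE LETTER** (one index set): a real-linear flat right inverse `H₁` of `X ↦ (π(qLin (lv i) 1 X (bd i)))_i`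
with letter `‖↑(H₁ y)‖ ≤ B‖y‖` gives `ρ′ > 0` and, at EVERY `U₀` with `‖↑U₀ − 1‖ < ρ′`, a right inverse `H₁ ∘ G` AT `U₀` with `‖G y‖ ≤ 2‖y‖`, `‖↑(H₁(G y))‖ ≤ 2B‖y‖`
(`exists_radius_rightInverse_suProj_qLin` at `ι`). [cite: Balaban1985Variational, (44)-(46) p.285; Balaban1985Averaging, Prop. 3 (121)-(125) p.36] -/
theorem exists_rightInverse_suProj_qLin_of_flat_letter (k : ℕ) (lv : ι → ℕ) (hlv : ∀ i, lv i ≤ k) (bd : (i : ι) → PBond P (lv i))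
    (H₁ : (ι → lieSU (Fin N)) →ₗ[ℝ] (PBond P 0 → lieSU (Fin N)))
    (h₁ : ∀ y i, suProj N (qLin (lv i) (1 : GaugeField P 0 (SU N)) (H₁ y) (bd i)) = y i)
    {B : ℝ} (hB0 : 0 ≤ B) (hB : ∀ y, ‖(fun b => (H₁ y b : Matrix (Fin N) (Fin N) ℂ))‖ ≤ B * ‖y‖) :
    ∃ ρ' : ℝ, 0 < ρ' ∧ ∀ U : GaugeField P 0 (SU N), ‖coeField U - 1‖ < ρ' →
      ∃ G : (ι → lieSU (Fin N)) →ₗ[ℝ] (ι → lieSU (Fin N)),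
        (∀ y i, suProj N (qLin (lv i) U (H₁ (G y)) (bd i)) = y i) ∧ (∀ y, ‖G y‖ ≤ 2 * ‖y‖) ∧
          ∀ y, ‖(fun b => (H₁ (G y) b : Matrix (Fin N) (Fin N) ℂ))‖ ≤ 2 * B * ‖y‖ := by
  obtain ⟨ρ', hρ', h⟩ := exists_radius_rightInverse_suProj_qLin (P := P) (N := N) k hB0
  exact ⟨ρ', hρ', fun U hU => h lv hlv bd H₁ h₁ hB U hU⟩

omit [NeZero N] in
/-- The coefficient map `X ↦ ↑X` (an `𝔰𝔲(N)`-valued field read as a matrix field) after a linear `H₁` from a finite-dimensional space is bounded: the letter of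
`exists_rightInverse_suProj_qLin_of_flat_letter` always holds with SOME `B ≥ 0`. [folklore] -/
theorem exists_letter_of_linear (H₁ : (ι → lieSU (Fin N)) →ₗ[ℝ] (PBond P 0 → lieSU (Fin N))) :
    ∃ B : ℝ, 0 ≤ B ∧ ∀ y, ‖(fun b => (H₁ y b : Matrix (Fin N) (Fin N) ℂ))‖ ≤ B * ‖y‖ := by
  let coeL : (PBond P 0 → lieSU (Fin N)) →ₗ[ℝ] (PBond P 0 → Matrix (Fin N) (Fin N) ℂ) := ((lieSU (Fin N)).subtype).compLeft (PBond P 0)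
  have hcoe : ∀ X, coeL X = fun b => (X b : Matrix (Fin N) (Fin N) ℂ) := fun X => rfl
  let Lmap : (ι → lieSU (Fin N)) →ₗ[ℝ] (PBond P 0 → Matrix (Fin N) (Fin N) ℂ) := coeL ∘ₗ H₁
  have hcont : Continuous Lmap := LinearMap.continuous_of_finiteDimensional Lmap
  obtain ⟨B, hBpos, hB⟩ := SemilinearMapClass.bound_of_continuous Lmap hcont
  exact ⟨B, hBpos.le, fun y => by simpa only [Lmap, LinearMap.comp_apply, hcoe] using hB y⟩

/-- ★ **THE RIGHT INVERSE AT A GUARDED NEAR-FLAT BACKGROUND (letter-free edition)**: ANY real-linear flat right inverse `H₁` of `X ↦ (π(qLin (lv i) 1 X (bd i)))_i` yields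
`ρ′ > 0` and, at every `U₀` with `‖↑U₀ − 1‖ < ρ′`, a real-linear right inverse of `X ↦ (π(qLin (lv i) U₀ X (bd i)))_i` of the form `H₁ ∘ G` (same range as `H₁`).
[cite: Balaban1985Variational, (44)-(46) p.285; Balaban1985Averaging, Prop. 3 (121)-(125) p.36] -/
theorem exists_rightInverse_suProj_qLin_of_flat (k : ℕ) (lv : ι → ℕ) (hlv : ∀ i, lv i ≤ k) (bd : (i : ι) → PBond P (lv i))
    (H₁ : (ι → lieSU (Fin N)) →ₗ[ℝ] (PBond P 0 → lieSU (Fin N)))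
    (h₁ : ∀ y i, suProj N (qLin (lv i) (1 : GaugeField P 0 (SU N)) (H₁ y) (bd i)) = y i) :
    ∃ ρ' : ℝ, 0 < ρ' ∧ ∀ U : GaugeField P 0 (SU N), ‖coeField U - 1‖ < ρ' →
      ∃ G : (ι → lieSU (Fin N)) →ₗ[ℝ] (ι → lieSU (Fin N)), ∀ y i, suProj N (qLin (lv i) U (H₁ (G y)) (bd i)) = y i := by
  obtain ⟨B, hB0, hB⟩ := exists_letter_of_linear (P := P) (N := N) H₁
  obtain ⟨ρ', hρ', h⟩ := exists_rightInverse_suProj_qLin_of_flat_letter k lv hlv bd H₁ h₁ hB0 hB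
  exact ⟨ρ', hρ', fun U hU => by obtain ⟨G, hG, -, -⟩ := h U hU; exact ⟨G, hG⟩⟩

end QLin

/-! ## §3  At NODE 00's chart: a right inverse of `DΦ_{U₀}(0)` (dag-n12-w3's `hLH`) at a guarded near-flat `U₀` -/

section Chart

variable {F : T4Family} {N : ℕ} [NeZero N] {K k : ℕ}

/-- ★★★ **ONE RADIUS FOR A RIGHT INVERSE OF `DΦ_{U₀}(0)` AT ALL GUARDED NEAR-FLAT BACKGROUNDS, ALL DETERMINING SETS OF LEVELS `≤ k`, WITH THE LETTER.**  For a letter constant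
`B ≥ 0`: ONE `ρ′ > 0` such that for EVERY determining set `𝔹`, EVERY real-linear right inverse `H₁` AT THE FLAT BACKGROUND of the linearised constraint on the enumerated constrained
bonds of levels `≤ k` (`π(qLin j 1 (H₁ y) c) = y_{(j,c)}`) with letter `‖↑(H₁ y)‖ ≤ B‖y‖`, and EVERY `U₀` on 35e's plaquette guard (`stokesConst·t₀ < δ_N`, averages below `k`
`t₀`-small — the chart's differentiability) with `‖↑U₀ − 1‖ < ρ′`: a real-linear `G` with `fderiv ℝ (msChart F N K k 𝔹 (M˙U₀) U₀) 0 (H₁ (G y)) = y` for all `y` (dag-n12-w3's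
`hLH : DΨ(0)(H y) = y`, VERBATIM, at a CURVED base, `H := H₁ ∘ G`), `‖G y‖ ≤ 2‖y‖`, `‖↑(H₁(G y))‖ ≤ 2B‖y‖`. (§2 at `ι := Fin (constrCard 𝔹 k)` + module E's
`fderiv_msChart_apply_eq_suProj_qLin`.) [cite: Balaban1985Variational, (44)-(48) p.285, (82)-(83) p.290; Balaban1988Convergent, (2.10)-(2.12) p.256] -/
theorem exists_radius_rightInverse_fderiv_msChart (k : ℕ) {B : ℝ} (hB0 : 0 ≤ B) :
    ∃ ρ' : ℝ, 0 < ρ' ∧ ∀ (𝔹 : DetSet (F.P K)) (H₁ : (Fin (constrCard 𝔹 k) → lieSU (Fin N)) →ₗ[ℝ] (PBond (F.P K) 0 → lieSU (Fin N)))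
      (_ : ∀ y i, suProj N (qLin (((constrEnum 𝔹 k).symm i).1 : ℕ) (1 : GaugeField (F.P K) 0 (SU N)) (H₁ y) ((constrEnum 𝔹 k).symm i).2.1) = y i)
      (_ : ∀ y, ‖(fun b => (H₁ y b : Matrix (Fin N) (Fin N) ℂ))‖ ≤ B * ‖y‖)
      ⦃t₀ : ℝ⦄, 0 < t₀ → stokesConst (F.P K) * t₀ < deltaSU (Fin N) →
      ∀ U : GaugeField (F.P K) 0 (SU N), (∀ i, i < k → PlaqSmall t₀ (Averaging.iter (avOfRecord F N K) i U)) → ‖coeField U - 1‖ < ρ' →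
        ∃ G : (Fin (constrCard 𝔹 k) → lieSU (Fin N)) →ₗ[ℝ] (Fin (constrCard 𝔹 k) → lieSU (Fin N)),
          (∀ y, fderiv ℝ (msChart F N K k 𝔹 (avgFamily (avOfRecord F N K) U) U) 0 (H₁ (G y)) = y) ∧ (∀ y, ‖G y‖ ≤ 2 * ‖y‖) ∧
            ∀ y, ‖(fun b => (H₁ (G y) b : Matrix (Fin N) (Fin N) ℂ))‖ ≤ 2 * B * ‖y‖ := by
  obtain ⟨ρ', hρ', h⟩ := exists_radius_rightInverse_suProj_qLin (P := F.P K) (N := N) k hB0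
  refine ⟨ρ', hρ', fun 𝔹 H₁ h₁ hB t₀ ht₀ hstδ U hsm hU => ?_⟩
  obtain ⟨G, hG, hGn, hHB⟩ := h (fun i : Fin (constrCard 𝔹 k) => (((constrEnum 𝔹 k).symm i).1 : ℕ))
    (fun i => Nat.lt_succ_iff.1 ((constrEnum 𝔹 k).symm i).1.2) (fun i => ((constrEnum 𝔹 k).symm i).2.1) H₁ h₁ hB U hU
  refine ⟨G, fun y => funext fun i => ?_, hGn, hHB⟩
  rw [fderiv_msChart_apply_eq_suProj_qLin ht₀ hstδ hsm 𝔹 (H₁ (G y)) i]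
  exact hG y i

/-- ★★★ **A RIGHT INVERSE OF `DΦ_{U₀}(0)` AT A GUARDED NEAR-FLAT BACKGROUND, WITH THE LETTER** (one determining set): a real-linear flat right inverse `H₁` on the enumerated
constrained bonds of `𝔹` (levels `≤ k`) with letter `‖↑(H₁ y)‖ ≤ B‖y‖` gives `ρ′ > 0` such that at EVERY guarded `U₀` with `‖↑U₀ − 1‖ < ρ′` some real-linear `G` makes
`fderiv ℝ (msChart F N K k 𝔹 (M˙U₀) U₀) 0 (H₁ (G y)) = y` for all `y`, with `‖G y‖ ≤ 2‖y‖`, `‖↑(H₁(G y))‖ ≤ 2B‖y‖` (`exists_radius_rightInverse_fderiv_msChart` at `𝔹`).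
[cite: Balaban1985Variational, (44)-(48) p.285, (82)-(83) p.290; Balaban1988Convergent, (2.10)-(2.12) p.256] -/
theorem exists_rightInverse_fderiv_msChart_of_flat_letter (𝔹 : DetSet (F.P K))
    (H₁ : (Fin (constrCard 𝔹 k) → lieSU (Fin N)) →ₗ[ℝ] (PBond (F.P K) 0 → lieSU (Fin N)))
    (h₁ : ∀ y i, suProj N (qLin (((constrEnum 𝔹 k).symm i).1 : ℕ) (1 : GaugeField (F.P K) 0 (SU N)) (H₁ y) ((constrEnum 𝔹 k).symm i).2.1) = y i)
    {B : ℝ} (hB0 : 0 ≤ B) (hB : ∀ y, ‖(fun b => (H₁ y b : Matrix (Fin N) (Fin N) ℂ))‖ ≤ B * ‖y‖) :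
    ∃ ρ' : ℝ, 0 < ρ' ∧ ∀ ⦃t₀ : ℝ⦄, 0 < t₀ → stokesConst (F.P K) * t₀ < deltaSU (Fin N) →
      ∀ U : GaugeField (F.P K) 0 (SU N), (∀ i, i < k → PlaqSmall t₀ (Averaging.iter (avOfRecord F N K) i U)) → ‖coeField U - 1‖ < ρ' →
        ∃ G : (Fin (constrCard 𝔹 k) → lieSU (Fin N)) →ₗ[ℝ] (Fin (constrCard 𝔹 k) → lieSU (Fin N)),
          (∀ y, fderiv ℝ (msChart F N K k 𝔹 (avgFamily (avOfRecord F N K) U) U) 0 (H₁ (G y)) = y) ∧ (∀ y, ‖G y‖ ≤ 2 * ‖y‖) ∧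
            ∀ y, ‖(fun b => (H₁ (G y) b : Matrix (Fin N) (Fin N) ℂ))‖ ≤ 2 * B * ‖y‖ := by
  obtain ⟨ρ', hρ', h⟩ := exists_radius_rightInverse_fderiv_msChart (F := F) (N := N) (K := K) k hB0
  exact ⟨ρ', hρ', fun t₀ ht₀ hstδ U hsm hU => h 𝔹 H₁ h₁ hB ht₀ hstδ U hsm hU⟩

/-- ★ **A RIGHT INVERSE OF `DΦ_{U₀}(0)` AT A GUARDED NEAR-FLAT BACKGROUND (letter-free)**: any flat right inverse `H₁` on the enumerated constrained bonds of `𝔹` ⟹ `ρ′ > 0` and,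
at every guarded `U₀` with `‖↑U₀ − 1‖ < ρ′`, a real-linear `H` (of the form `H₁ ∘ G`) with `fderiv ℝ (msChart F N K k 𝔹 (M˙U₀) U₀) 0 (H y) = y`. [cite: Balaban1985Variational,
(44)-(48) p.285, (82)-(83) p.290; Balaban1988Convergent, (2.10)-(2.12) p.256] -/
theorem exists_rightInverse_fderiv_msChart_of_flat (𝔹 : DetSet (F.P K))
    (H₁ : (Fin (constrCard 𝔹 k) → lieSU (Fin N)) →ₗ[ℝ] (PBond (F.P K) 0 → lieSU (Fin N)))
    (h₁ : ∀ y i, suProj N (qLin (((constrEnum 𝔹 k).symm i).1 : ℕ) (1 : GaugeField (F.P K) 0 (SU N)) (H₁ y) ((constrEnum 𝔹 k).symm i).2.1) = y i) :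
    ∃ ρ' : ℝ, 0 < ρ' ∧ ∀ ⦃t₀ : ℝ⦄, 0 < t₀ → stokesConst (F.P K) * t₀ < deltaSU (Fin N) →
      ∀ U : GaugeField (F.P K) 0 (SU N), (∀ i, i < k → PlaqSmall t₀ (Averaging.iter (avOfRecord F N K) i U)) → ‖coeField U - 1‖ < ρ' →
        ∃ H : (Fin (constrCard 𝔹 k) → lieSU (Fin N)) →ₗ[ℝ] (PBond (F.P K) 0 → lieSU (Fin N)),
          ∀ y, fderiv ℝ (msChart F N K k 𝔹 (avgFamily (avOfRecord F N K) U) U) 0 (H y) = y := by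
  obtain ⟨B, hB0, hB⟩ := exists_letter_of_linear (P := F.P K) (N := N) H₁
  obtain ⟨ρ', hρ', h⟩ := exists_rightInverse_fderiv_msChart_of_flat_letter 𝔹 H₁ h₁ hB0 hB
  refine ⟨ρ', hρ', fun t₀ ht₀ hstδ U hsm hU => ?_⟩
  obtain ⟨G, hG, -, -⟩ := h ht₀ hstδ U hsm hU
  exact ⟨H₁ ∘ₗ G, fun y => by rw [LinearMap.comp_apply]; exact hG y⟩

/-- **`DΦ_{U₀}(0)` IS ONTO at every guarded near-flat background** carrying a flat right inverse on the constrained bonds of `𝔹` (surjectivity persists from the flat background).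
[cite: Balaban1985Variational, (44)-(48) p.285] -/
theorem surjective_fderiv_msChart_of_flat (𝔹 : DetSet (F.P K))
    (H₁ : (Fin (constrCard 𝔹 k) → lieSU (Fin N)) →ₗ[ℝ] (PBond (F.P K) 0 → lieSU (Fin N)))
    (h₁ : ∀ y i, suProj N (qLin (((constrEnum 𝔹 k).symm i).1 : ℕ) (1 : GaugeField (F.P K) 0 (SU N)) (H₁ y) ((constrEnum 𝔹 k).symm i).2.1) = y i) :
    ∃ ρ' : ℝ, 0 < ρ' ∧ ∀ ⦃t₀ : ℝ⦄, 0 < t₀ → stokesConst (F.P K) * t₀ < deltaSU (Fin N) →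
      ∀ U : GaugeField (F.P K) 0 (SU N), (∀ i, i < k → PlaqSmall t₀ (Averaging.iter (avOfRecord F N K) i U)) → ‖coeField U - 1‖ < ρ' →
        Function.Surjective (fderiv ℝ (msChart F N K k 𝔹 (avgFamily (avOfRecord F N K) U) U) 0) := by
  obtain ⟨ρ', hρ', h⟩ := exists_rightInverse_fderiv_msChart_of_flat 𝔹 H₁ h₁
  refine ⟨ρ', hρ', fun t₀ ht₀ hstδ U hsm hU y => ?_⟩
  obtain ⟨H, hH⟩ := h ht₀ hstδ U hsm hU
  exact ⟨H y, hH y⟩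

end Chart

end Summit.QuantumFields.YangMills.BalabanUVNodes.N12GuardedLinAvgRightInverse

end
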